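import Literature.NumberTheory.EllipticCurves.ThreeIsogeny
import Literature.NumberTheory.EllipticCurves.MordellCurvePhiDescentHom
import Summits.BirchSwinnertonDyer.BirchSwinnertonDyer.Theorems.Rank2ObservatoryThreeIsoDual
import Summits.BirchSwinnertonDyer.BirchSwinnertonDyer.Theorems.Rank2ObservatoryThreeIsoDescentHom
import Summits.BirchSwinnertonDyer.BirchSwinnertonDyer.Theorems.Rank2ObservatoryThreeIsoKernelE

/-!
# BirchSwinnertonDyer — rank ≥ 2 observatory, KERNEL-3ISO (A6 frame): the per-row assembly lemma

HONEST FRAMING: per-curve certified theorems and census instruments; no claim on BSD in rank ≥ 2.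

The per-row certificates of the `3`-isogeny-descent leg (`KERNEL-3ISO`, rank-`2` rows with a rational
`3`-torsion point, model `E_{m,s} : y² = x³ + (mx + s)²`) all end the same way: the E-side descent map
`κ : E(ℚ) → ℚ*/ℚ*³` (A3 `exists_threeDescentHom`, kernel `ψ(Ê(ℚ))` by A3b `ker_descent_le_range` and the
explicit dual `ψ`, `ψ ∘ φ = [n]`, A1' `exists_dual_pointHom`) has image in a finite set `S`, an Ê-side
descent map `κ'` with `ker κ' ≤ φ(E(ℚ))` has image in a finite set `S'`, and
`3^(r+1) ≤ #S · #S' < 3^(r₀+2)` gives `rank_ℤ ≤ r₀` (A1 `mordellWeilRank_le_of_card_mul_card_lt_of_zsmul`).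
This file packages that once:

* `exists_threeDescentHom_rat` — A3 restated over `ℚ` at the ambient `DecidableEq ℚ` instance (the generic
  A3 is elaborated at the classical instance; per-row files and A3b/A4/A5 use `instDecidableEqRat`);
* `three_nsmul_T` — `3 • T = 0`; `exists_descent_package` — A1' + A3 + A3b bundled (`ψ, n, κ` with
  `ψ ∘ φ = [n]`, `3 ∣ n ≠ 0`, the values of `κ`, `ker κ ≤ ψ(E'(ℚ))`);
* `mordellWeilRank_le_of_images` — **the assembly**: from ANY additive `κ'` on `Ê(ℚ)` with
  `ker κ' ≤ φ(E(ℚ))` and image in `S'`, and an E-side image bound `S` valid for every additive `κ` with the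
  A3 values, `#S · #S' < 3^(r₀+2) ⇒ rank_ℤ E_{m,s}(ℚ) ≤ r₀`. Per-row files supply only the two image bounds
  (E-side: A4 `descent_value_mem` + A5 `descent_value_ne_of_kill`; Ê-side: B1/B3 + B4).

No definitions. References: H. Cohen, *Number Theory I* (GTM 239, 2007), §8.4, Prop. 8.4.3, 8.4.8;
H. Cohen, F. Pazuki, *Elementary 3-descent with a 3-isogeny*, Acta Arith. 140 (2009), arXiv:0903.4963, §1–2.
-/

set_option linter.dupNamespace false

noncomputable section

open WeierstrassCurve

namespace Summit.BirchSwinnertonDyer.BirchSwinnertonDyer.Rank2Observatory.ThreeIso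

open Literature.NumberTheory.EllipticCurves Literature.NumberTheory.EllipticCurves.MordellDescent
open ThreeIsoDescent

/-- **A3 over `ℚ` at the ambient decidability instance.** The E-side `3`-descent map with its values
`κ(x, y) = [y - (mx + s)]` (`[(2s)²]` at `T`). [cite: Cohen2007NumberTheoryI, Def. 8.4.7, Prop. 8.4.8 (1)] -/
theorem exists_threeDescentHom_rat [DecidableEq ℚ] {m s : ℚ} {W W' : WeierstrassCurve ℚ}
    (h : IsVeluThreePair m s W W') :
    ∃ κ : W.toAffine.Point →+ Additive (CubeUnits ℚ), ∀ (x y : ℚ) (hP : W.toAffine.Nonsingular x y),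
      κ (.some x y hP) =
        Additive.ofMul (cubeClass (if y = m * x + s then (2 * s) ^ 2 else y - (m * x + s))) := by
  obtain rfl : ‹DecidableEq ℚ› = fun a b ↦ Classical.propDecidable (a = b) := Subsingleton.elim _ _
  exact exists_threeDescentHom h

/-- `3 • T = 0` for the rational `3`-torsion point `T = (0, s)`. [folklore] -/
theorem three_nsmul_T {F : Type*} [Field F] [DecidableEq F] {m s : F} {W W' : WeierstrassCurve F}
    (h : IsVeluThreePair m s W W') : 3 • h.T = 0 := by
  rw [succ_nsmul, two_nsmul, h.T_add_T, neg_add_cancel]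

/-- **The E-side package** (A1' + A3 + A3b at the ambient decidability instance): an explicit dual
`ψ` with `ψ ∘ φ = [n]`, `n ≠ 0`, `3 ∣ n`, and the `3`-descent map `κ` with its values and
`ker κ ≤ ψ(E'(ℚ))`. [cite: Cohen2007NumberTheoryI, Prop. 8.4.3, Prop. 8.4.8 (1)–(2)] -/
theorem exists_descent_package [DecidableEq ℚ] {m s : ℚ}
    (h : IsVeluThreePair m s (threeTorsionModel m s) (threeIsogenyCodomain m s)) :
    ∃ (ψ : (threeIsogenyCodomain m s).toAffine.Point →+ (threeTorsionModel m s).toAffine.Point) (n : ℤ)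
      (κ : (threeTorsionModel m s).toAffine.Point →+ Additive (CubeUnits ℚ)),
      n ≠ 0 ∧ 3 ∣ n ∧ (∀ P, ψ (h.pointHom P) = n • P) ∧
      (∀ (x y : ℚ) (hP : (threeTorsionModel m s).toAffine.Nonsingular x y),
        κ (.some x y hP) =
          Additive.ofMul (cubeClass (if y = m * x + s then (2 * s) ^ 2 else y - (m * x + s)))) ∧
      κ.ker ≤ ψ.range := by
  obtain rfl : ‹DecidableEq ℚ› = instDecidableEqRat := Subsingleton.elim _ _
  obtain ⟨ψ, n, hn0, h3n, hψφ, hψval⟩ := exists_dual_pointHom h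
  obtain ⟨κ, hκ⟩ := exists_threeDescentHom_rat h
  exact ⟨ψ, n, κ, hn0, h3n, hψφ, hκ, ker_descent_le_range h κ hκ ψ hψval⟩

/-- **The per-row assembly of the `3`-isogeny descent (A6 frame).** For the model pair
`(E_{m,s}, E'_{m,s})` over `ℚ`: given any additive `κ'` on `E'(ℚ)` with `ker κ' ≤ φ(E(ℚ))` and image in a
finite set `S'`, and a finite set `S` containing the image of every additive `κ` on `E(ℚ)` with the
`3`-descent values, if `#S · #S' < 3^(r₀+2)` then `rank_ℤ E_{m,s}(ℚ) ≤ r₀` (explicit dual `ψ` with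
`ψ ∘ φ = [n]`, `3 ∣ n`; `ker κ ≤ ψ(E'(ℚ))`; index count `3^(r+1) ≤ #S · #S'`).
[cite: Cohen2007NumberTheoryI, Prop. 8.4.3, Prop. 8.4.8] [cite: CohenPazuki2009, Prop. 1.4, Prop. 2.2] -/
theorem mordellWeilRank_le_of_images [DecidableEq ℚ] {m s : ℚ}
    (h : IsVeluThreePair m s (threeTorsionModel m s) (threeIsogenyCodomain m s))
    {G' : Type*} [AddCommGroup G'] (κ' : (threeIsogenyCodomain m s).toAffine.Point →+ G')
    (hκ' : κ'.ker ≤ h.pointHom.range) (S' : Finset G') (hS' : ∀ Q, κ' Q ∈ S')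
    (S : Finset (Additive (CubeUnits ℚ)))
    (hS : ∀ κ : (threeTorsionModel m s).toAffine.Point →+ Additive (CubeUnits ℚ),
      (∀ (x y : ℚ) (hP : (threeTorsionModel m s).toAffine.Nonsingular x y),
        κ (.some x y hP) =
          Additive.ofMul (cubeClass (if y = m * x + s then (2 * s) ^ 2 else y - (m * x + s)))) →
      ∀ P, κ P ∈ S)
    (r₀ : ℕ) (hr : S.card * S'.card < 3 ^ (r₀ + 2)) : (threeTorsionModel m s).mordellWeilRank ≤ r₀ := by
  -- the index lemma (A1) is elaborated at the classical instance: move everything there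
  obtain rfl : ‹DecidableEq ℚ› = fun a b ↦ Classical.propDecidable (a = b) := Subsingleton.elim _ _
  letI instDecEqRat : DecidableEq ℚ := fun a b ↦ Classical.propDecidable (a = b)
  haveI : (threeTorsionModel m s).IsElliptic := ⟨isUnit_iff_ne_zero.mpr h.Δ_ne⟩
  obtain ⟨ψ, n, κ, hn0, h3n, hψφ, hκ, hκker⟩ := exists_descent_package h
  exact mordellWeilRank_le_of_card_mul_card_lt_of_zsmul _ h.pointHom ψ n hn0 h3n hψφ h.T (three_nsmul_T h)
    h.T_ne_zero κ κ' hκker hκ' S S' (hS κ hκ) hS' r₀ hr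

end Summit.BirchSwinnertonDyer.BirchSwinnertonDyer.Rank2Observatory.ThreeIso

end
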